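import Mathlib
import Summits.NavierStokesRegularity.NavierStokesRegularity.Theorems.LevelSetModerationHighSpeedPressureWorkIsoSpeedAreaOfCrux
import Summits.NavierStokesRegularity.NavierStokesRegularity.Theorems.LevelSetModerationHighSpeedPressureWorkIsoSpeedStubs
import Summits.NavierStokesRegularity.NavierStokesRegularity.Theorems.LevelSetModerationHighSpeedPressureWorkLevelSetIBP
import Summits.NavierStokesRegularity.NavierStokesRegularity.Theorems.LevelSetModerationHighSpeedPressureWorkSliceDecay
import Literature.Analysis.FluidPDE.NormalisedPressureDischarge
import Literature.Analysis.FluidPDE.PressureRepresentation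

/-!
# Route LevelSetModeration — `HighSpeedPressureWork`: the pairing bound from a pressure bound on the fast set

Support file for item stmt-NavierStokesRegularity-18149 (`HighSpeedPressureWork`). The crux asks for
`PW_c(t) ≤ √(F M^m V_c(T)) √(D_c(T))`, where
`PW_c(t) = -∫₀ᵗ∫ (1 - c/|u|)₊ D(p̃[u τ])(x)(u τ x)` is the pressure work on the super-level set
`{c < |u|}`, `V_c(T) = ∫₀ᵀ |{c < |u(τ)|}| dτ` and `D_c(T) = ∫₀ᵀ∫ 1_{c<|u|} ‖D|u|‖²`. This file proves
the elementary half of every "bounded-strength" closure of the crux: **a pointwise bound `|p̃| ≤ K`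
for the normalised pressure ON THE FAST SET gives the pairing bound with `F M^m = K²`**:

* `levelSetModeration_slicePairing_le_of_pressureBound` — one time slice: by the level-set
  integration by parts (`stub_levelSetIBP`, Vasseur 2007 Lemma 11)
  `-∫ (1 - c/|v|)₊ Dq(v) = ∫ 1_{c<|v|} (c/|v|²)(D|v|(v)) q`, and `|c/|v|² D|v|(v)| ≤ ‖D|v|‖` on the
  fast set, so `-∫ (1 - c/|v|)₊ Dq(v) ≤ K ∫ 1_{c<|v|} ‖D|v|‖` whenever `|q| ≤ K` on `{c < |v|}`;
* `levelSetModeration_pairing_le_of_pressureBound` — integrated in time for a classical Leray–Hopf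
  solution: `PW_c(t) ≤ K 𝒟¹_c(T) ≤ K √(V_c(T)) √(D_c(T)) = √(K² V_c(T)) √(D_c(T))`, with the area
  functional `𝒟¹_c(T) = ∫₀ᵀ∫ 1_{c<|u|} ‖D|u|‖` and the Cauchy–Schwarz inequality
  `𝒟¹ ≤ √V √D` (`levelSetModeration_isoSpeedArea_le_sqrt`).

Tools recorded on the way: the normalised pressure of every interior slice IS the classical
pressure up to a constant (`levelSetModeration_normalisedPressure_slice_eq`, Tao's normalisation,
Lemma 4.1 (i) of Tao 2013, from the tree's `pressure_sub_pressurePotential_eq` and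
`normalisedPressure_eq_pressurePotential`), hence `C^∞`
(`levelSetModeration_contDiff_normalisedPressure_slice`); and the a.e.-measurability in time of
the area slice `τ ↦ ∫ 1_{c<|u τ|} ‖D|u τ|‖` (`levelSetModeration_aemeasurable_areaSlice`).
-/

noncomputable section

-- single-conjunct summit: `Summit.<Summit>.<Problem>` repeats the name by the D-0017 layout
set_option linter.dupNamespace false

namespace Summit.NavierStokesRegularity.NavierStokesRegularity.Theorems

open MeasureTheory Set Filter Topology Function
open scoped ENNReal RealInnerProductSpace
open Literature.Analysis.FluidPDE

/-! ### The normalised pressure of the slices is the pressure -/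

/-- **Tao's normalisation, slice by slice.** For a classical solution of the unforced system on
`[0,T)` which is Leray–Hopf on `[0,T]` (`ν ≥ 0`) and every interior time `τ ∈ (0,T)`, the
principal-value normalised pressure of the slice is the classical pressure up to a constant:
`p̃[u τ] = p τ - (p τ 0 - Q[u τ](0))` as functions on `ℝ³` (Tao 2013, Lemma 4.1 (i); in the tree
`pressure_sub_pressurePotential_eq` + `normalisedPressure_eq_pressurePotential`, applied to the
restriction of the solution to `[0, (τ+T)/2]` with the energy bound `∫‖u t‖² ≤ ∫‖u 0‖²`).
[cite: Tao2011, Lemma 4.1 (i)] -/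
theorem levelSetModeration_normalisedPressure_slice_eq {ν T : ℝ}
    {u : ℝ → EuclideanSpace ℝ (Fin 3) → EuclideanSpace ℝ (Fin 3)}
    {p : ℝ → EuclideanSpace ℝ (Fin 3) → ℝ}
    (hcl : IsClassicalNSSolutionOn (Ico 0 T) ν 0 u p) (hLH : IsLerayHopfOn T ν 0 (u 0) u)
    (hν : 0 ≤ ν) {τ : ℝ} (hτ : τ ∈ Ioo 0 T) :
    normalisedPressure (u τ) = fun x => p τ x - (p τ 0 - pressurePotential (u τ) 0) := by
  -- restrict to the closed interval `[0, T']`, `τ < T' < T`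
  set T' := (τ + T) / 2 with hT'
  have hτT' : τ < T' := by rw [hT']; linarith [hτ.2]
  have hT'T : T' < T := by rw [hT']; linarith [hτ.2]
  have hT'0 : 0 < T' := hτ.1.trans hτT'
  have hsub : Icc 0 T' ⊆ Ico 0 T := fun t ht => ⟨ht.1, ht.2.trans_lt hT'T⟩
  have hcl' : IsClassicalNSSolutionOn (Icc 0 T') ν 0 u p := hcl.mono hsub (uniqueDiffOn_Icc hT'0)
  have hint : ∀ t ∈ Icc 0 T', Integrable fun y => ‖u t y‖ ^ 2 := fun t ht =>
    (integral_norm_sq_le_of_lerayHopf hLH hν ⟨ht.1, ht.2.trans hT'T.le⟩).1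
  have hE : ∀ t ∈ Icc 0 T', ∫ y, ‖u t y‖ ^ 2 ≤ ∫ y, ‖u 0 y‖ ^ 2 := fun t ht =>
    (integral_norm_sq_le_of_lerayHopf hLH hν ⟨ht.1, ht.2.trans hT'T.le⟩).2
  have hE0 : 0 ≤ ∫ y, ‖u 0 y‖ ^ 2 := integral_nonneg fun _ => sq_nonneg _
  have hτ' : τ ∈ Ioo 0 T' := ⟨hτ.1, hτT'⟩
  have hu2 : ContDiff ℝ 2 (u τ) := contDiff_infty.1 (hcl.contDiff_velocity ⟨hτ.1.le, hτ.2⟩) 2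
  funext x
  rw [normalisedPressure_eq_pressurePotential hu2 (hint τ ⟨hτ.1.le, hτT'.le⟩) x]
  have := pressure_sub_pressurePotential_eq hν hcl' hE0 hint hE hτ' x
  linarith

/-- The normalised pressure of every interior slice is `C^∞` (it is the classical pressure up
to a constant, `levelSetModeration_normalisedPressure_slice_eq`). [cite: Tao2011, Lemma 4.1 (i)] -/
theorem levelSetModeration_contDiff_normalisedPressure_slice {ν T : ℝ}
    {u : ℝ → EuclideanSpace ℝ (Fin 3) → EuclideanSpace ℝ (Fin 3)}
    {p : ℝ → EuclideanSpace ℝ (Fin 3) → ℝ}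
    (hcl : IsClassicalNSSolutionOn (Ico 0 T) ν 0 u p) (hLH : IsLerayHopfOn T ν 0 (u 0) u)
    (hν : 0 ≤ ν) {τ : ℝ} (hτ : τ ∈ Ioo 0 T) :
    ContDiff ℝ (⊤ : ℕ∞) (normalisedPressure (u τ)) := by
  rw [levelSetModeration_normalisedPressure_slice_eq hcl hLH hν hτ]
  exact (hcl.contDiff_pressure ⟨hτ.1.le, hτ.2⟩).sub contDiff_const

/-! ### Measurability in time of the area slice -/

/-- **Time-measurability of the area slice** `τ ↦ ∫ 1_{c<|u τ|} ‖D|u τ|‖` (power one) of a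
jointly smooth field on `[0,T) × ℝ³`, for `dt|_{(0,t)}`, `t ≤ T`: the density is continuous on the
(measurable) super-level set of the speed inside the slab, and Tonelli's measurability theorem
applies. Companion of `levelSetModeration_aemeasurable_dissipationSlice` (power two). [folklore] -/
theorem levelSetModeration_aemeasurable_areaSlice {T : ℝ}
    {u : ℝ → EuclideanSpace ℝ (Fin 3) → EuclideanSpace ℝ (Fin 3)}
    (hu : IsSmoothSpaceTimeOn (Ico 0 T) u) {c : ℝ} (hc : 0 < c) {t : ℝ} (ht : t ≤ T) :
    AEMeasurable (fun τ => ∫⁻ x, {x | c < ‖u τ x‖}.indicator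
        (fun x => ENNReal.ofReal ‖fderiv ℝ (fun y => ‖u τ y‖) x‖) x)
      (volume.restrict (Ioo 0 t)) := by
  rcases le_or_gt t 0 with ht0 | ht0
  · rw [Ioo_eq_empty (not_lt.2 ht0), Measure.restrict_empty]
    exact aemeasurable_zero_measure
  set Ω : Set (ℝ × EuclideanSpace ℝ (Fin 3)) := Ico 0 T ×ˢ univ with hΩ
  have hUΩ : UniqueDiffOn ℝ (Ico 0 T) := uniqueDiffOn_Ico 0 T
  set W : Set (ℝ × EuclideanSpace ℝ (Fin 3)) := {z | z ∈ Ω ∧ c < ‖uncurry u z‖} with hW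
  have hcontu : ContinuousOn (uncurry u) Ω := hu.continuousOn
  have hWmeas : MeasurableSet W := levelSetModeration_measurableSet_superlevel_slab hcontu c
  have hWΩ : W ⊆ Ω := fun z hz => hz.1
  -- the density
  set Dslab : ℝ × EuclideanSpace ℝ (Fin 3) →
      (ℝ × EuclideanSpace ℝ (Fin 3) →L[ℝ] EuclideanSpace ℝ (Fin 3)) :=
    fderivWithin ℝ (uncurry u) Ω with hDslab
  set G : ℝ × EuclideanSpace ℝ (Fin 3) → ℝ≥0∞ := fun z =>
    ENNReal.ofReal ‖(‖uncurry u z‖⁻¹ • innerSL ℝ (uncurry u z)).comp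
      ((Dslab z).comp (ContinuousLinearMap.inr ℝ ℝ (EuclideanSpace ℝ (Fin 3))))‖ with hG
  have hDcont : ContinuousOn Dslab Ω := (hu.contDiffOn_fderivWithin hUΩ).continuousOn
  have hGcont : ContinuousOn G W := by
    have hne : ∀ z ∈ W, ‖uncurry u z‖ ≠ 0 := fun z hz => (hc.trans hz.2).ne'
    have h1 : ContinuousOn (fun z => ‖uncurry u z‖⁻¹) W := (hcontu.mono hWΩ).norm.inv₀ hne
    have h2 : ContinuousOn (fun z => innerSL ℝ (uncurry u z)) W :=
      (innerSL ℝ).continuous.comp_continuousOn (hcontu.mono hWΩ)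
    have h3 : ContinuousOn (fun z => (Dslab z).comp
        (ContinuousLinearMap.inr ℝ ℝ (EuclideanSpace ℝ (Fin 3)))) W :=
      ((hDcont.mono hWΩ).clm_comp continuousOn_const)
    have h4 : ContinuousOn (fun z => (‖uncurry u z‖⁻¹ • innerSL ℝ (uncurry u z)).comp
        ((Dslab z).comp (ContinuousLinearMap.inr ℝ ℝ (EuclideanSpace ℝ (Fin 3))))) W :=
      (h1.smul h2).clm_comp h3
    exact ENNReal.continuous_ofReal.comp_continuousOn h4.norm
  -- a.e.-measurability of the density for the product measure
  have hΨ : AEMeasurable (W.indicator G)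
      ((volume.restrict (Ioo 0 t)).prod (volume : Measure (EuclideanSpace ℝ (Fin 3)))) := by
    rw [aemeasurable_indicator_iff hWmeas]
    exact hGcont.aemeasurable hWmeas
  have hTon := hΨ.lintegral_prod_right'
  -- identification with the slice quantity for `τ ∈ (0, t)`
  refine hTon.congr ?_
  filter_upwards [ae_restrict_mem measurableSet_Ioo] with τ hτ
  have hτ' : τ ∈ Ico 0 T := ⟨hτ.1.le, hτ.2.trans_le ht⟩
  refine lintegral_congr fun x => ?_
  by_cases hx : c < ‖u τ x‖
  · have hzW : (τ, x) ∈ W := ⟨mk_mem_prod hτ' (mem_univ x), hx⟩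
    rw [indicator_of_mem hzW, indicator_of_mem (show x ∈ {x | c < ‖u τ x‖} from hx), hG]
    -- chain rule for the speed gradient at a point where `u τ x ≠ 0`
    have hx0 : u τ x ≠ 0 := by
      intro h0; rw [h0, norm_zero] at hx; exact absurd hx (not_lt.2 hc.le)
    have hdu : DifferentiableAt ℝ (u τ) x :=
      ((hu.contDiff_slice hτ').differentiable (by simp)) x
    have hchain : fderiv ℝ (fun y => ‖u τ y‖) x =
        (‖u τ x‖⁻¹ • innerSL ℝ (u τ x)).comp (fderiv ℝ (u τ) x) := by
      have h := (LevelSetEnergyInequality.hasFDerivAt_norm_of_ne_zero hx0).comp x hdu.hasFDerivAt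
      exact h.fderiv
    rw [hchain, hu.fderiv_slice_eq hτ' x]
    rfl
  · have hzW : (τ, x) ∉ W := fun h => hx h.2
    rw [indicator_of_notMem hzW, indicator_of_notMem (show x ∉ {x | c < ‖u τ x‖} from hx)]

/-! ### One slice: the pairing is bounded by `K` times the area slice -/

/-- **Slice pairing bound from a pressure bound on the fast set.** For `v ∈ C¹(ℝ³; ℝ³)` divergence
free with bounded `{c < |v|}` (`c > 0`), `q ∈ C¹(ℝ³)` with `|q| ≤ K` on `{c < |v|}`:
`-∫ (1 - c/|v|)₊ Dq(x)(v x) dx ≤ K ∫ 1_{c<|v|} ‖D|v|(x)‖ dx` (level-set integration by parts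
`stub_levelSetIBP`, then `|c/|v|² D|v|(v)| ≤ ‖D|v|‖` on the fast set). [folklore] -/
theorem levelSetModeration_slicePairing_le_of_pressureBound
    {v : EuclideanSpace ℝ (Fin 3) → EuclideanSpace ℝ (Fin 3)} {q : EuclideanSpace ℝ (Fin 3) → ℝ}
    {c K : ℝ} (hc : 0 < c) (hv : ContDiff ℝ 1 v) (hq : ContDiff ℝ 1 q)
    (hdiv : VectorCalculus.IsDivFree v) (hbdd : Bornology.IsBounded {x | c < ‖v x‖})
    (hK : ∀ x, c < ‖v x‖ → |q x| ≤ K) :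
    -(∫ x, max (1 - c / ‖v x‖) 0 * (fderiv ℝ q x (v x))) ≤
      K * (∫⁻ x, {x | c < ‖v x‖}.indicator
        (fun x => ENNReal.ofReal ‖fderiv ℝ (fun y => ‖v y‖) x‖) x).toReal := by
  rw [stub_levelSetIBP v q c hc hv hq hdiv hbdd]
  set A : Set (EuclideanSpace ℝ (Fin 3)) := {x | c < ‖v x‖} with hA
  set f : EuclideanSpace ℝ (Fin 3) → ℝ := fun x => ‖fderiv ℝ (fun y => ‖v y‖) x‖ with hf
  -- integrability of the area density on the (bounded) fast set
  have hf_int : Integrable (A.indicator f) volume :=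
    levelSetModeration_integrable_indicator_superlevel hc hv hbdd fun x hx =>
      (levelSetModeration_continuousAt_fderiv_norm hv hx).norm
  have hg_int : Integrable (A.indicator fun x => K * f x) volume := by
    have h := hf_int.const_mul K
    refine h.congr (Eventually.of_forall fun x => ?_)
    by_cases hx : x ∈ A
    · simp only [indicator_of_mem hx]
    · simp only [indicator_of_notMem hx, mul_zero]
  -- pointwise domination of the pairing density
  have hle : ∀ x, ‖A.indicator (fun x => c / ‖v x‖ ^ 2 * (fderiv ℝ (fun y => ‖v y‖) x (v x)) * q x) x‖ ≤
      A.indicator (fun x => K * f x) x := by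
    intro x
    by_cases hx : x ∈ A
    · rw [indicator_of_mem hx, indicator_of_mem hx, Real.norm_eq_abs, abs_mul]
      have h1 := levelSetModeration_abs_pairingDensity_le hc (show c < ‖v x‖ from hx)
      have h2 := hK x hx
      calc |c / ‖v x‖ ^ 2 * (fderiv ℝ (fun y => ‖v y‖) x (v x))| * |q x|
          ≤ ‖fderiv ℝ (fun y => ‖v y‖) x‖ * K := mul_le_mul h1 h2 (abs_nonneg _) (norm_nonneg _)
        _ = K * f x := by rw [hf, mul_comm]
    · rw [indicator_of_notMem hx, indicator_of_notMem hx, norm_zero]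
  have hdom := norm_integral_le_of_norm_le hg_int (Eventually.of_forall hle)
  -- the majorant integral is `K` times the area slice
  have hind : (A.indicator fun x => K * f x) = fun x => K * A.indicator f x := by
    funext x
    by_cases hx : x ∈ A
    · simp only [indicator_of_mem hx]
    · simp only [indicator_of_notMem hx, mul_zero]
  have hAmeas : MeasurableSet A := (isOpen_lt continuous_const hv.continuous.norm).measurableSet
  have hreal : ∫ x, A.indicator f x =
      (∫⁻ x, A.indicator (fun x => ENNReal.ofReal ‖fderiv ℝ (fun y => ‖v y‖) x‖) x).toReal := by
    rw [integral_eq_lintegral_of_nonneg_ae (Eventually.of_forall fun x =>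
      indicator_nonneg (fun y _ => norm_nonneg _) x) hf_int.aestronglyMeasurable]
    congr 1
    refine lintegral_congr fun x => ?_
    by_cases hx : x ∈ A
    · simp only [indicator_of_mem hx]
    · simp only [indicator_of_notMem hx, ENNReal.ofReal_zero]
  calc ∫ x, A.indicator (fun x => c / ‖v x‖ ^ 2 * (fderiv ℝ (fun y => ‖v y‖) x (v x)) * q x) x
      ≤ ‖∫ x, A.indicator (fun x => c / ‖v x‖ ^ 2 * (fderiv ℝ (fun y => ‖v y‖) x (v x)) * q x) x‖ :=
        Real.le_norm_self _
    _ ≤ ∫ x, A.indicator (fun x => K * f x) x := hdom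
    _ = K * ∫ x, A.indicator f x := by rw [hind, integral_const_mul]
    _ = K * (∫⁻ x, A.indicator (fun x => ENNReal.ofReal ‖fderiv ℝ (fun y => ‖v y‖) x‖) x).toReal := by
        rw [hreal]

/-! ### Integrated in time: the pairing bound of the crux from a pressure bound on the fast set -/

/-- **The pairing bound from a pressure bound on the fast set.** Let `u` be a classical solution of
unforced Navier–Stokes on `ℝ³ × [0,T)` (`ν, T > 0`), Leray–Hopf from a rapidly decaying datum,
`c > 0`, `0 ≤ s`, `t ∈ [0,T)`, `K ≥ 0`. If `|p̃[u τ](x)| ≤ K` at every `τ ∈ (s,t)` and every fast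
point `c < |u τ x|`, then the pressure work over the time window `(s,t)` obeys
`-∫ₛᵗ∫ (1 - c/|u|)₊ D(p̃[u τ])(u) ≤ √(K² V_c(T)) √(D_c(T))`:
slice by slice the pairing is at most `K ∫ 1_{c<|u|} ‖D|u|‖`
(`levelSetModeration_slicePairing_le_of_pressureBound`; the slices `p̃[u τ]` are `C^∞`,
`levelSetModeration_contDiff_normalisedPressure_slice`), the time integral of the area slices is
the area functional `𝒟¹_c(t) ≤ 𝒟¹_c(T) < ∞`, and `𝒟¹_c(T) ≤ √(V_c(T)) √(D_c(T))`
(`levelSetModeration_isoSpeedArea_le_sqrt`). This is the form in which every a priori `L^∞` bound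
on the normalised pressure over the fast set enters the crux `HighSpeedPressureWork`. [folklore] -/
theorem levelSetModeration_pairing_le_of_pressureBound {ν T : ℝ}
    {u : ℝ → EuclideanSpace ℝ (Fin 3) → EuclideanSpace ℝ (Fin 3)}
    {p : ℝ → EuclideanSpace ℝ (Fin 3) → ℝ} (hν : 0 < ν) (hT : 0 < T)
    (hcl : IsClassicalNSSolutionOn (Ico 0 T) ν 0 u p) (hLH : IsLerayHopfOn T ν 0 (u 0) u)
    (hdec : HasRapidSpatialDecay (u 0)) {c s t K : ℝ} (hc : 0 < c) (hs : 0 ≤ s) (ht : t ∈ Ico 0 T)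
    (hK0 : 0 ≤ K) (hK : ∀ τ ∈ Ioo s t, ∀ x, c < ‖u τ x‖ → |normalisedPressure (u τ) x| ≤ K) :
    -(∫ τ in Ioo s t, ∫ x, max (1 - c / ‖u τ x‖) 0 *
        (fderiv ℝ (normalisedPressure (u τ)) x (u τ x))) ≤
      Real.sqrt (K ^ 2 * (∫⁻ τ in Ioo 0 T, volume {x | c < ‖u τ x‖}).toReal) *
        Real.sqrt ((∫⁻ τ in Ioo 0 T, ∫⁻ x, {x | c < ‖u τ x‖}.indicator
          (fun x => ENNReal.ofReal (‖fderiv ℝ (fun y => ‖u τ y‖) x‖ ^ 2)) x).toReal) := by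
  -- names
  set V : ℝ≥0∞ := ∫⁻ τ in Ioo 0 T, volume {x | c < ‖u τ x‖} with hV
  set D : ℝ≥0∞ := ∫⁻ τ in Ioo 0 T, ∫⁻ x, {x | c < ‖u τ x‖}.indicator
    (fun x => ENNReal.ofReal (‖fderiv ℝ (fun y => ‖u τ y‖) x‖ ^ 2)) x with hDdef
  set S : ℝ → ℝ≥0∞ := fun τ => ∫⁻ x, {x | c < ‖u τ x‖}.indicator
    (fun x => ENNReal.ofReal ‖fderiv ℝ (fun y => ‖u τ y‖) x‖) x with hS
  set P : ℝ → ℝ := fun τ => ∫ x, max (1 - c / ‖u τ x‖) 0 *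
    (fderiv ℝ (normalisedPressure (u τ)) x (u τ x)) with hP
  have hVfin : V ≠ ⊤ :=
    ne_top_of_le_ne_top ENNReal.ofReal_ne_top (levelSetVolume_le hLH hν.le hT.le hc)
  have hDfin : D ≠ ⊤ := (levelSetDissipation_ne_top hcl hLH hT hν.le hc.le).1
  have hAfin : ∫⁻ τ in Ioo 0 T, S τ ≠ ⊤ := levelSetModeration_isoSpeedArea_ne_top hν hT hcl hLH hc
  -- (a) the slice inequality for every `τ ∈ (s, t)`
  have hslice : ∀ τ ∈ Ioo s t, -P τ ≤ K * (S τ).toReal := by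
    intro τ hτ
    have hτT : τ ∈ Ioo 0 T := ⟨hs.trans_lt hτ.1, hτ.2.trans ht.2⟩
    have hτ' : τ ∈ Ico 0 T := ⟨hτT.1.le, hτT.2⟩
    have hv : ContDiff ℝ 1 (u τ) := (hcl.contDiff_velocity hτ').of_le (by norm_cast)
    have hq : ContDiff ℝ 1 (normalisedPressure (u τ)) :=
      (levelSetModeration_contDiff_normalisedPressure_slice hcl hLH hν.le hτT).of_le (by norm_cast)
    have hdiv : VectorCalculus.IsDivFree (u τ) := hcl.divFree τ hτ'
    have hbdd : Bornology.IsBounded {x | c < ‖u τ x‖} :=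
      levelSetModeration_isBounded_superlevel ν T u p hν hcl hLH hdec τ hτ' c hc
    exact levelSetModeration_slicePairing_le_of_pressureBound hc hv hq hdiv hbdd (hK τ hτ)
  -- (b) measurability, finiteness and the real time integral of the area slices
  have hsub_t : Ioo s t ⊆ Ioo 0 t := Ioo_subset_Ioo hs le_rfl
  have hSmeas : AEMeasurable S (volume.restrict (Ioo s t)) :=
    (levelSetModeration_aemeasurable_areaSlice hcl.smooth_velocity hc ht.2.le).mono_measure
      (Measure.restrict_mono hsub_t le_rfl)
  have hsubT : Ioo s t ⊆ Ioo 0 T := Ioo_subset_Ioo hs ht.2.le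
  have hAt_le : ∫⁻ τ in Ioo s t, S τ ≤ ∫⁻ τ in Ioo 0 T, S τ := lintegral_mono_set hsubT
  have hAtfin : ∫⁻ τ in Ioo s t, S τ ≠ ⊤ := ne_top_of_le_ne_top hAfin hAt_le
  have hSint : Integrable (fun τ => (S τ).toReal) (volume.restrict (Ioo s t)) :=
    integrable_toReal_of_lintegral_ne_top hSmeas hAtfin
  have hSreal : ∫ τ in Ioo s t, (S τ).toReal = (∫⁻ τ in Ioo s t, S τ).toReal :=
    integral_toReal hSmeas (ae_lt_top' hSmeas hAtfin)
  -- (c) `-∫ P ≤ K ∫ S`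
  have hmain : -(∫ τ in Ioo s t, P τ) ≤ K * (∫⁻ τ in Ioo s t, S τ).toReal := by
    rw [← integral_neg, ← hSreal, ← integral_const_mul]
    have hKS : Integrable (fun τ => K * (S τ).toReal) (volume.restrict (Ioo s t)) :=
      hSint.const_mul K
    by_cases hInt : Integrable (fun τ => -P τ) (volume.restrict (Ioo s t))
    · refine integral_mono_ae hInt hKS ?_
      filter_upwards [ae_restrict_mem measurableSet_Ioo] with τ hτ
      exact hslice τ hτ
    · rw [integral_undef hInt]
      exact integral_nonneg fun τ => mul_nonneg hK0 ENNReal.toReal_nonneg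
  -- (d) Cauchy–Schwarz `𝒟¹_c(T) ≤ √V √D` in real form
  have hCS := levelSetModeration_isoSpeedArea_le_sqrt hcl.smooth_velocity hc (T := T)
  have hCSr : (∫⁻ τ in Ioo 0 T, S τ).toReal ≤ Real.sqrt V.toReal * Real.sqrt D.toReal := by
    have h1 := ENNReal.toReal_mono (ENNReal.mul_ne_top
      (ENNReal.rpow_ne_top_of_nonneg (by norm_num) hVfin)
      (ENNReal.rpow_ne_top_of_nonneg (by norm_num) hDfin)) hCS
    rwa [ENNReal.toReal_mul, ← ENNReal.toReal_rpow, ← ENNReal.toReal_rpow, ← Real.sqrt_eq_rpow,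
      ← Real.sqrt_eq_rpow] at h1
  have hAt_real : (∫⁻ τ in Ioo s t, S τ).toReal ≤ (∫⁻ τ in Ioo 0 T, S τ).toReal :=
    ENNReal.toReal_mono hAfin hAt_le
  -- (e) assemble: `K √V √D = √(K² V) √D`
  have hsq : Real.sqrt (K ^ 2 * V.toReal) = K * Real.sqrt V.toReal := by
    rw [Real.sqrt_mul (sq_nonneg K), Real.sqrt_sq hK0]
  calc -(∫ τ in Ioo s t, P τ) ≤ K * (∫⁻ τ in Ioo s t, S τ).toReal := hmain
    _ ≤ K * (∫⁻ τ in Ioo 0 T, S τ).toReal := mul_le_mul_of_nonneg_left hAt_real hK0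
    _ ≤ K * (Real.sqrt V.toReal * Real.sqrt D.toReal) := mul_le_mul_of_nonneg_left hCSr hK0
    _ = Real.sqrt (K ^ 2 * V.toReal) * Real.sqrt D.toReal := by rw [hsq]; ring

/-- **The pairing bound from a pressure bound on the fast set** (registered sub-goal of the crux
item stmt-NavierStokesRegularity-18149, closed form of
`levelSetModeration_pairing_le_of_pressureBound`): for a classical Leray–Hopf solution on
`ℝ³ × [0,T)` from a rapidly decaying datum, `c > 0`, `t ∈ [0,T)`, `K ≥ 0`, a bound `|p̃[u τ]| ≤ K`
on the fast set `{c < |u τ|}` for all `τ ∈ (0,t)` gives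
`-∫₀ᵗ∫ (1 - c/|u|)₊ D(p̃[u τ])(u) ≤ √(K² V_c(T)) √(D_c(T))`. [folklore] -/
theorem levelSetModeration_pairingOfPressureBound :
    ∀ (ν T : ℝ) (u : ℝ → EuclideanSpace ℝ (Fin 3) → EuclideanSpace ℝ (Fin 3)) (p : ℝ → EuclideanSpace ℝ (Fin 3) → ℝ), 0 < ν → 0 < T → Literature.Analysis.FluidPDE.IsClassicalNSSolutionOn (Set.Ico 0 T) ν 0 u p → Literature.Analysis.FluidPDE.IsLerayHopfOn T ν 0 (u 0) u → Literature.Analysis.FluidPDE.HasRapidSpatialDecay (u 0) → ∀ (c t K : ℝ), 0 < c → t ∈ Set.Ico 0 T → 0 ≤ K → (∀ τ ∈ Set.Ioo 0 t, ∀ x, c < ‖u τ x‖ → |Literature.Analysis.FluidPDE.normalisedPressure (u τ) x| ≤ K) → -(∫ τ in Set.Ioo 0 t, ∫ x, max (1 - c / ‖u τ x‖) 0 * (fderiv ℝ (Literature.Analysis.FluidPDE.normalisedPressure (u τ)) x (u τ x))) ≤ Real.sqrt (K ^ 2 * (∫⁻ τ in Set.Ioo 0 T, MeasureTheory.volume {x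 | c < ‖u τ x‖}).toReal) * Real.sqrt ((∫⁻ τ in Set.Ioo 0 T, ∫⁻ x, Set.indicator {x | c < ‖u τ x‖} (fun x => ENNReal.ofReal (‖fderiv ℝ (fun y => ‖u τ y‖) x‖ ^ 2)) x).toReal) :=
  fun _ _ _ _ hν hT hcl hLH hdec _ _ _ hc ht hK0 hK =>
    levelSetModeration_pairing_le_of_pressureBound hν hT hcl hLH hdec hc le_rfl ht hK0 hK

end Summit.NavierStokesRegularity.NavierStokesRegularity.Theorems

end
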